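import Summits.QuantumFields.BalabanUV.T4Continuum.Spine.NE2.ComposedRemainderGaugeTowerFlat
import Summits.QuantumFields.BalabanUV.T4Continuum.Spine.NE2.ComposedRemainderRateLetters

/-!
# T⁴ programme, spine node NE2 (U1a) — R14 W3d, file 2: THE GAUGE-TOWER END WITH NO REAL-INEQUALITY BINDER — print's letter shapes in, `Γ`, `E`, `C_r`, `c_U` out
# (cell `pub-balaban-gaps`, seat ne2 gen 7; after `ComposedRemainderGaugeTower` (gen 6, file 7) and `ComposedRemainderRateLetters` (gen 7))

`ComposedRemainderGaugeTower.composed_full_averaging_rate_of_gaugeTowers` displays, beside the data letters on the towers of unitary bond variables, a free closeness family `c_U` (`hcU0`,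
`hUd`), free reals `Γ`, `E`, `C_r` and the three real inequalities `hΓ`, `hE`, `hrate` tying them to the letters, plus the per-level plaquette threshold `hpL`.  THIS FILE removes all of
them: with PRINT's LETTER SHAPES — sizes `‖U − 1‖ ≤ α_U/L^i`, NE3-type closeness `‖U^{(k+1)} − U^{(k)}‖ ≤ σ_Uθ_c^k/L^i` on the chain `i ≤ k` (nothing asked beyond the chain: unitarity gives
`≤ 2` there, `consC`), plaquette letters `p_{k,i} ≤ p_U/L^{2i}` ([B9] (3.35): `|∂A| = O(η²)` in lattice units; [B7] (143)) and ONE numerical threshold `d·p_U ≤ 1/16` — the closeness family is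
`consC L σ_U θ_c`, `Γ := Γ_U`, `E := E_U`, `C_r := CrU` (closed forms of `ComposedRemainderRateLetters`) and `hΓ`/`hE`/`hrate` are the theorems `sum_gamma_le`/`sum_eps_le`/`rate_le`.
 * **`composed_full_averaging_rate_of_geometricLetters`** — the (3.26)-shape END with print's composed averaging + (124)'s remainders whose displayed objects are EXACTLY: the towers `U` of
   unitary bond variables with the four letters (`α_U`, `σ_U`, `θ_c`, `p ≤ p_U/L^{2i}`), the loop logarithms in the frame's carrier (`hYP`), the frame `hF`, tier-B data `R` (`hreg`) +
   node NE3 BY NAME (`hNE3`) + `P₄` (`hP₄`), the rate `ρ ∈ [max(θ_c, 3/(2L)), 1)`, and ONE closed-form smallness inequality `hsmall` in (`a`, `α_R`, `β_R`, `C`, `α_U`, `p_U`, `κ₄`);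
 * **`composed_full_averaging_rate_of_geometricLetters_flat`** — non-vacuity at the flat point (as file 9).
REMAINS (located, unchanged): the letters themselves for Bałaban's minimiser and its [B7] (15)-averages (G2 = NE3 + F6 (ζ)), (W2″), (R7).
HONEST FRAMING (T4-DAG p. 1).  A COMPOSITION of kernel theorems about MODEL objects; `U`, `R`, `P₄`, the frame are DATA asserted by nobody; NE3 OPEN by name; nothing of Bałaban's asserted
beyond the displayed readings; NOT an instance of Bałaban's minimiser or of (3.35); NOT NE2, NOT [B9] (3.16)/(3.26) or [B7] (124)/(143) as printed; **NE2 (U1a) NOT PROVED**; spine PROVED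
0/9 unchanged; NOT continuum YM / infinite volume / mass gap / Clay.  HONEST DEPENDENCY: continuum YM on T⁴ ⇐ BetaPertH ∧ nine spine estimates (0/9 proved).  No `sorry`.
-/

noncomputable section

open scoped BigOperators ComplexConjugate Matrix Matrix.Norms.L2Operator Kronecker
open Finset (range)

namespace Summit.QuantumFields.BalabanUV.T4Continuum.NE2.ComposedRemainderGaugeTowerGeometric

open Literature.MathematicalPhysics.QuantumFieldTheory.Balaban1983to89.B5Prop11Plancherel (Tor fine unitVec Cst)
open Literature.MathematicalPhysics.QuantumFieldTheory.Balaban1983to89.B5G183RateUnitTower (lev lev_neZero)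
open Literature.MathematicalPhysics.QuantumFieldTheory.Balaban1983to89.T4EtaRateMin (LocalRate)
open Summit.QuantumFields.BalabanUV.Beta.AdjointCarrierWiringEnd (CompFamily)
open Summit.QuantumFields.BalabanUV.T4Continuum
open Summit.QuantumFields.BalabanUV.T4Continuum.BalabanAveragedTowerUnit (idx Qlev)
open Summit.QuantumFields.BalabanUV.T4Continuum.KingPairingPlantedLaw (JpcT calDalev CJ)
open Summit.QuantumFields.BalabanUV.T4Continuum.GramPerturbationLaw (C2gram)
open Summit.QuantumFields.BalabanUV.T4Continuum.CovariantAveragingTower (TowerLimitRate)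
open Summit.QuantumFields.BalabanUV.T4Continuum.BackgroundResolventTower (PerturbationLaws Cpert)
open Summit.QuantumFields.BalabanUV.T4Continuum.PerturbationAlgebra (perturbationLaws_zero perturbationLaws_mono)
open Summit.QuantumFields.BalabanUV.T4Continuum.RegularBackgroundTower (RegularTransporters regClass betaNE3)
open Summit.QuantumFields.BalabanUV.T4Continuum.ColourCovariantLaplacian (kappaCol)
open Summit.QuantumFields.BalabanUV.T4Continuum.NE2FromNE3 (bgReadings)
open Summit.QuantumFields.BalabanUV.T4Continuum.CovariantAveragingSummand (kappaQ)
open Summit.QuantumFields.BalabanUV.T4Continuum.NE2BalabanLayer (tierBPert kappaB C2B)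
open Summit.QuantumFields.BalabanUV.T4Continuum.NE2BalabanGauge (liftR)
open Summit.QuantumFields.BalabanUV.T4Continuum.GaugeTermPerturbationLaw (oneR)
open Summit.QuantumFields.BalabanUV.T4Continuum.NE2BalabanFlatWitness (regularTransporters_flat localRate_flat)
open Summit.QuantumFields.BalabanUV.T4Continuum.NE2.CovariantTableBalaban (TBal)
open Summit.QuantumFields.BalabanUV.T4Continuum.NE2.ComposedAveragingMean (thetaZero consC consC_nonneg)
open Summit.QuantumFields.BalabanUV.T4Continuum.NE2.ComposedAveragingRemainder (avgPertFull)
open Summit.QuantumFields.BalabanUV.T4Continuum.NE2.ComposedRemainderTower (Erem cR)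
open Summit.QuantumFields.BalabanUV.T4Continuum.NE2.OneStepLoopHolonomy (norm_le_one_of_unitary)
open Summit.QuantumFields.BalabanUV.T4Continuum.NE2.OneStepRemainderLoopCoeff (YxT remCoeffOf)
open Summit.QuantumFields.BalabanUV.T4Continuum.NE2.OneStepRemainderLoopFlat (YxT_one)
open Summit.QuantumFields.BalabanUV.T4Continuum.NE2.ComposedRemainderGaugeTower (fundT adT composed_full_averaging_rate_of_gaugeTowers)
open Summit.QuantumFields.BalabanUV.T4Continuum.NE2.ComposedRemainderGaugeTowerFlat (flatU fundT_flatU)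
open Summit.QuantumFields.BalabanUV.T4Continuum.NE2.ComposedRemainderRateLetters (GamU EU CrU consC_of_le inv_lev_eq gamma_term_le sum_gamma_le sum_eps_le rate_le)

variable {d : ℕ} (L : ℕ) [NeZero L] (M : Fin d → ℕ) [hM : ∀ μ, NeZero (M μ)]
  {n : Type} [Fintype n] [DecidableEq n] {ι : Type} [Fintype ι] [DecidableEq ι] {c : ℝ} {P : Submodule ℝ (Matrix n n ℂ)} {e : ι → Matrix n n ℂ}
  (hF : CompFamily c P e) (a : ℝ) (ha : 0 < a) [Nonempty n] [Nonempty ι]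

/-! ## §1 The closeness family `consC` from the chain letter and unitarity; the plaquette threshold from `d·p_U ≤ 1/16` -/

omit [NeZero L] hM [Nonempty n] in
/-- closeness on ALL levels from the NE3-type letter on the chain `i ≤ k` and unitarity beyond: `‖U^{(k+1)}_i − U^{(k)}_i‖ ≤ consC L σ_U θ_c k i`. [folklore] -/
theorem norm_sub_le_consC {U : ℕ → (i : ℕ) → Fin d → (idx L M i → Matrix.unitaryGroup n ℂ)} {σU θc : ℝ}
    (hUc : ∀ k i ν b, i ≤ k → ‖(U (k + 1) i ν b : Matrix n n ℂ) - (U k i ν b : Matrix n n ℂ)‖ ≤ σU * θc ^ k / (lev L i : ℕ)) (k i : ℕ) (ν : Fin d) (b : idx L M i) :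
    ‖(U (k + 1) i ν b : Matrix n n ℂ) - (U k i ν b : Matrix n n ℂ)‖ ≤ consC L σU θc k i := by
  by_cases hik : i ≤ k
  · rw [consC_of_le hik, ← inv_lev_eq, ← div_eq_mul_inv]; exact hUc k i ν b hik
  · have e2 : consC L σU θc k i = 2 := by unfold consC; rw [if_neg hik]
    rw [e2]
    have h1 := norm_le_one_of_unitary (lev L i) M (V := fundT L M (U (k + 1)) i) (fun ν b => (U (k + 1) i ν b).2) ν b
    have h2 := norm_le_one_of_unitary (lev L i) M (V := fundT L M (U k) i) (fun ν b => (U k i ν b).2) ν b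
    calc ‖(U (k + 1) i ν b : Matrix n n ℂ) - (U k i ν b : Matrix n n ℂ)‖ ≤ ‖(U (k + 1) i ν b : Matrix n n ℂ)‖ + ‖(U k i ν b : Matrix n n ℂ)‖ := norm_sub_le _ _
      _ ≤ 1 + 1 := add_le_add h1 h2
      _ = 2 := by norm_num

omit [NeZero L] in
/-- the per-level plaquette threshold from the numerical one: `p_{k,i} ≤ p_U/L^{2i}` and `d·p_U ≤ 1/16` give `d·L²·p_{k,i+1} ≤ 1/16`. [folklore] -/
theorem plaquette_threshold (hL : 1 ≤ L) {p : ℕ → ℕ → ℝ} {pU : ℝ} (hpU0 : 0 ≤ pU) (hpU : ∀ k i, p k i ≤ pU * ((L : ℝ)⁻¹) ^ (2 * i)) (hpUs : d * pU ≤ 1 / 16) (k i : ℕ) :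
    d * (L : ℝ) ^ 2 * p k (i + 1) ≤ 1 / 16 := by
  have h := gamma_term_le (d := d) hL hpU k i
  have hLr : (1 : ℝ) ≤ L := by exact_mod_cast hL
  have h0 : (0 : ℝ) ≤ (L : ℝ)⁻¹ := inv_nonneg.mpr (by linarith)
  have hx : (((L : ℝ)⁻¹) ^ 2) ^ i ≤ 1 := pow_le_one₀ (pow_nonneg h0 2) (by nlinarith [inv_le_one_of_one_le₀ hLr])
  have hd : (0 : ℝ) ≤ d := Nat.cast_nonneg d
  nlinarith [mul_le_of_le_one_right (by positivity : (0 : ℝ) ≤ 64 * d * pU) hx]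

/-! ## §2 The END with print's letter shapes and no real-inequality binder -/

/-- **THE (3.26)-SHAPE END WITH THE FULL LINEARISED COMPOSED AVERAGING FOR TOWERS OF UNITARY GAUGE FIELDS, PRINT's LETTER SHAPES IN, NO REAL-INEQUALITY BINDER**:
`composed_full_averaging_rate_of_gaugeTowers` with `c_U := consC L σ_U θ_c` (from `hUc` + unitarity), `Γ := Γ_U`, `E := E_U`, `C_r := CrU` and `hΓ`/`hE`/`hrate`/`hpL`/`hcU0`/`hUd` PROVED
(`ComposedRemainderRateLetters.sum_gamma_le`/`sum_eps_le`/`rate_le`, `plaquette_threshold`, `norm_sub_le_consC`).  Displayed: the towers `U` with sizes `α_U/L^i`, chain closeness `σ_Uθ_c^k/L^i`,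
plaquette letters `p ≤ p_U/L^{2i}` (`d·p_U ≤ 1/16`), `Y_x ∈ P`; the frame `hF`; `hreg`, `hNE3`, `hP₄`; `ρ ∈ [max(θ_c, 3/(2L)), 1)`; ONE closed-form smallness inequality.
[cite: Balaban1985BackgroundPropagators, (3.3) p.390, (3.15)–(3.16) p.393, (3.26) p.395, (3.35) p.397; Balaban1985Averaging, (114) p.34, (124)–(126) p.36, (139)–(143) p.39; King1986, Lemma 4.5 (4.38) p.674 (method)] [folklore] -/
theorem composed_full_averaging_rate_of_geometricLetters (hL : 2 ≤ L) (hd : 1 ≤ d) {R : (k : ℕ) → Fin d → (idx L M k → Matrix ι ι ℂ)} {αR βR : ℝ}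
    (hreg : RegularTransporters L M R αR βR) {C : ℝ} (hC : 0 ≤ C) (hNE3 : LocalRate (bgReadings L M (regClass L M R)) C ((L : ℝ)⁻¹))
    {U : ℕ → (i : ℕ) → Fin d → (idx L M i → Matrix.unitaryGroup n ℂ)} {αU σU θc ρ pU : ℝ}
    (hαU : 0 ≤ αU) (hσU : 0 ≤ σU) (hθ0 : 0 ≤ θc) (hθ1 : θc ≤ 1) (hθρ : θc ≤ ρ) (hρ : 3 / (2 * (L : ℝ)) ≤ ρ) (hρ1 : ρ < 1)
    (hUa : ∀ k i ν b, ‖(U k i ν b : Matrix n n ℂ) - 1‖ ≤ αU / (lev L i : ℕ))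
    (hUc : ∀ k i ν b, i ≤ k → ‖(U (k + 1) i ν b : Matrix n n ℂ) - (U k i ν b : Matrix n n ℂ)‖ ≤ σU * θc ^ k / (lev L i : ℕ))
    {p : ℕ → ℕ → ℝ} (hp0 : ∀ k i, 0 ≤ p k i)
    (hp : ∀ k i (x : Tor (fine (L * lev L i) M)) (ν μ : Fin d),
      ‖fundT L M (U k) (i + 1) ν (x, μ) * fundT L M (U k) (i + 1) μ (x + unitVec (fine (L * lev L i) M) ν, μ) - fundT L M (U k) (i + 1) μ (x, μ) * fundT L M (U k) (i + 1) ν (x + unitVec (fine (L * lev L i) M) μ, μ)‖ ≤ p k (i + 1))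
    (hpU0 : 0 ≤ pU) (hpU : ∀ k i, p k i ≤ pU * ((L : ℝ)⁻¹) ^ (2 * i)) (hpUs : d * pU ≤ 1 / 16) (hYP : ∀ k i x μ r, YxT L M (fundT L M (U k)) i x μ r ∈ P)
    {P₄ : (k : ℕ) → Matrix (idx L M k × ι) (idx L M k × ι) ℂ} {κ₄ C₄ : ℝ}
    (hP₄ : PerturbationLaws (fun k => calDalev L M a ha k ⊗ₖ (1 : Matrix ι ι ℂ)) P₄ (fun k => JpcT L M k ⊗ₖ (1 : Matrix ι ι ℂ)) κ₄ (fun k => C₄ * ρ ^ k))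
    (hsmall : kappaB ι d a αR βR C (kappaQ d a (a : ℂ) (Fintype.card ι * (Real.exp ((((d + 1) * L : ℕ) : ℝ) * (2 * αU)) - 1)
      + (1 + Fintype.card ι * (Real.exp ((((d + 1) * L : ℕ) : ℝ) * (2 * αU)) - 1)) * cR d L ι * GamU d pU * Real.exp (EU ι d L αU pU))) κ₄ < 1) :
    TowerLimitRate (fun k => Qlev L M k ⊗ₖ (1 : Matrix ι ι ℂ)) ((L : ℝ) ^ d)
      (fun k => (calDalev L M a ha k ⊗ₖ (1 : Matrix ι ι ℂ)
        + tierBPert L M R (avgPertFull L M a (fun k => TBal L M (adT L M hF (U k)) k) (fun k => Erem L M (adT L M hF (U k)) (remCoeffOf L M (fundT L M (U k)) c e (adT L M hF (U k))) k)) P₄ k)⁻¹)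
      (Cpert (kappaB ι d a αR βR C (kappaQ d a (a : ℂ) (Fintype.card ι * (Real.exp ((((d + 1) * L : ℕ) : ℝ) * (2 * αU)) - 1)
          + (1 + Fintype.card ι * (Real.exp ((((d + 1) * L : ℕ) : ℝ) * (2 * αU)) - 1)) * cR d L ι * GamU d pU * Real.exp (EU ι d L αU pU))) κ₄) (2 * d * Cst d a) (CJ d a)
        (C2B ι d L a αR βR C
          (a * C2gram (Cst d a) 1 (Fintype.card ι * (Real.exp ((((d + 1) * L : ℕ) : ℝ) * (2 * αU)) - 1)
              + (1 + Fintype.card ι * (Real.exp ((((d + 1) * L : ℕ) : ℝ) * (2 * αU)) - 1)) * cR d L ι * GamU d pU * Real.exp (EU ι d L αU pU)) (2 * d * Cst d a) (CJ d a) (Cst d a)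
            (Cst d a * Fintype.card ι * (thetaZero d L (2 * αU) (2 * σU) + (Real.exp ((((d + 1) * L : ℕ) : ℝ) * (2 * αU)) - 1)) + CrU ι d L a αU σU pU)) C₄) 0 1) ρ :=
  composed_full_averaging_rate_of_gaugeTowers L M hF a ha hL hd hreg hC hNE3 hαU hσU hθ0 hθ1 hθρ hρ hρ1 hUa hUc hp0 hp
    (fun k i => plaquette_threshold (d := d) L (by omega) hpU0 hpU hpUs k i) hYP (cU := consC L σU θc) (Γ := GamU d pU) (E := EU ι d L αU pU) (Cr := CrU ι d L a αU σU pU)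
    (fun k i => consC_nonneg L hσU hθ0 k i) (fun k i ν b => norm_sub_le_consC L M hUc k i ν b)
    (fun k k' => sum_gamma_le hL hpU0 hpU k k') (fun k k' => sum_eps_le hL hαU hpU0 hpU k k')
    (fun k => rate_le hL a hαU hσU hθ0 hθ1 hθρ hρ hpU0 hp0 hpU k) hP₄ hsmall

/-! ## §3 Non-vacuity at the flat tower -/

include ha in
/-- **NON-VACUITY**: at the flat point (`R` flat, `U ≡ 1`, `P₄ = 0`, `α_U = σ_U = θ_c = p_U = 0`, `p ≡ 0`) every displayed binder of `composed_full_averaging_rate_of_geometricLetters` holds,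
for any component family `hF`, `L ≥ 2`, `d ≥ 1`, `3/(2L) ≤ ρ < 1`.  NOT a statement about non-trivial data; NE2 NOT proved. [folklore] -/
theorem composed_full_averaging_rate_of_geometricLetters_flat (hL : 2 ≤ L) (hd : 1 ≤ d) {ρ : ℝ} (hρ : 3 / (2 * (L : ℝ)) ≤ ρ) (hρ1 : ρ < 1) :
    ∃ Cp : ℝ, TowerLimitRate (fun k => Qlev L M k ⊗ₖ (1 : Matrix ι ι ℂ)) ((L : ℝ) ^ d)
      (fun k => (calDalev L M a ha k ⊗ₖ (1 : Matrix ι ι ℂ)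
        + tierBPert L M (liftR L M (oneR L M (o := ι))) (avgPertFull L M a (fun k => TBal L M (adT L M hF (flatU L M)) k)
            (fun k => Erem L M (adT L M hF (flatU L M)) (remCoeffOf L M (fundT L M (flatU L M)) c e (adT L M hF (flatU L M))) k)) (fun _ => 0) k)⁻¹) Cp ρ := by
  have hρ0 : 0 ≤ ρ := le_trans (by positivity) hρ
  have hone : ∀ (i : ℕ) (ν : Fin d) (b : idx L M i), ((flatU L M (n := n) i ν b : Matrix.unitaryGroup n ℂ) : Matrix n n ℂ) = 1 := fun _ _ _ => rfl
  have hP₄ : PerturbationLaws (fun k => calDalev L M a ha k ⊗ₖ (1 : Matrix ι ι ℂ)) (fun k => (0 : Matrix (idx L M k × ι) (idx L M k × ι) ℂ))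
      (fun k => JpcT L M k ⊗ₖ (1 : Matrix ι ι ℂ)) 0 (fun k => (0 : ℝ) * ρ ^ k) :=
    perturbationLaws_mono perturbationLaws_zero le_rfl fun k => le_of_eq (by ring)
  have hexp : Real.exp ((((d + 1) * L : ℕ) : ℝ) * (2 * 0)) - 1 = 0 := by rw [mul_zero, mul_zero, Real.exp_zero, sub_self]
  have hG : GamU d 0 = 0 := by unfold GamU; rw [mul_zero]
  have hsmall : kappaB ι d a 0 0 0 (kappaQ d a (a : ℂ) (Fintype.card ι * (Real.exp ((((d + 1) * L : ℕ) : ℝ) * (2 * 0)) - 1)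
      + (1 + Fintype.card ι * (Real.exp ((((d + 1) * L : ℕ) : ℝ) * (2 * 0)) - 1)) * cR d L ι * GamU d 0 * Real.exp (EU ι d L 0 0))) 0 < 1 := by
    rw [hexp, hG]
    simp [kappaB, kappaCol, kappaQ, betaNE3]
  refine ⟨_, composed_full_averaging_rate_of_geometricLetters L M hF a ha hL hd (regularTransporters_flat L M) le_rfl
    (localRate_flat L M le_rfl (inv_nonneg.mpr (Nat.cast_nonneg L))) (U := fun _ => flatU L M) (αU := 0) (σU := 0) (θc := 0) (pU := 0) le_rfl le_rfl le_rfl zero_le_one hρ0 hρ hρ1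
    (fun _ _ _ _ => by rw [hone, sub_self, norm_zero]; positivity) (fun _ _ _ _ _ => by rw [hone, sub_self, norm_zero]; positivity)
    (p := fun _ _ => 0) (fun _ _ => le_rfl) (fun _ _ _ _ _ => by rw [fundT_flatU]; simp) le_rfl (fun _ _ => by rw [zero_mul]) (by rw [mul_zero]; norm_num)
    (fun _ i x μ r => by rw [fundT_flatU, YxT_one]; exact P.zero_mem) hP₄ hsmall⟩

end Summit.QuantumFields.BalabanUV.T4Continuum.NE2.ComposedRemainderGaugeTowerGeometric

end
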